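import Literature.NumberTheory.EllipticCurves.VariableChangePointsMap
import HarnessLib

/-!
# Changes of variables not defined over the base: Galois transport, composition, and the
# automorphisms `{1, ι}` of a Weierstrass equation with `c₄ c₆ ≠ 0`

Topic `NumberTheory/EllipticCurves`, namespace `WeierstrassCurve.VariableChange` (proof-only companion
of `VariableChangePoints(Map).lean`: no definition, no named fact; cell `abc-iut`, seat abc-iut-L2-t5).
Generic bricks for the TWISTED Tate uniformisation (Silverman, *Advanced Topics*, Lemma V.5.2 (c) /
Cor. V.5.4) and for "rational `n`-torsion forces split multiplicative reduction", where an
isomorphism `ψ : E → E_q` is a change of variables `C` with coefficients in `K̄`, NOT in `K`: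
* `map_congrEquiv_pointEquiv` — `σ(ψ_C(P)) = ψ_{C.map σ}(σ(P))` for a `K`-algebra map `σ` (the
  tree's `pointEquivBaseChange_map` is the case of a `C` defined over `K`, where `C.map σ = C`);
* `eq_one_or_eq_negY_of_smul_eq` — `C • W = W`, `c₄ c₆ ≠ 0`, `6 ≠ 0` ⇒ `C = 1` or
  `C = ι = (−1, 0, −a₁, −a₃)` (Silverman, *AEC*, III.10.1, case `j ≠ 0, 1728`: `Aut(E) = μ₂`);
  `negY_smul`: `ι • W = W`; `congrEquiv_pointEquiv_negY`: `ι` acts on points as `P ↦ −P`;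
* `congrEquiv_pointEquiv_mul` / `_one` — composition along `(D * C) • W = D • (C • W)`;
* `map_eq_self_or_eq_negY_mul` — hence `C.map σ ∈ {C, ι * C}`, decided by `σ u = u` or `σ u = −u`
  (`map_eq_self_of_map_u_eq`, `map_eq_negY_mul_of_map_u_ne`), and the two point-level cases
  `σ(ψ(P)) = ± ψ(σ(P))` (`map_congrEquiv_pointEquiv_of_map_eq`, `…_of_map_eq_negY_mul`).
All elementary algebra on Silverman's Table 3.1 (Mathlib `variableChange_a₁ … c₆`) and on the
coordinates `x' = u⁻²(x − r)`, `y' = u⁻³(y − s(x − r) − t)` (the tree's `VariableChange.toX/toY`).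

## References
* [SilvermanAEC2009] J. H. Silverman, *The Arithmetic of Elliptic Curves*, 2nd ed., GTM 106,
  III.1 Table 3.1 (p. 45), Thm. III.10.1 (p. 103).
* [SilvermanATAEC1994] J. H. Silverman, *Advanced Topics in the Arithmetic of Elliptic Curves*,
  GTM 151, Lemma V.5.2 (c) and Cor. V.5.4 (PDF pp. 406–410).
-/

noncomputable section

namespace WeierstrassCurve.VariableChange

universe u v w

/-! ### The automorphism `ι = (−1, 0, −a₁, −a₃)` and the classification `Aut = {1, ι}` -/

section NegY

variable {R : Type u} [CommRing R] (W : WeierstrassCurve R)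

/-- The change of variables `ι = (u, r, s, t) = (−1, 0, −a₁, −a₃)` fixes the Weierstrass equation:
`ι • W = W` (it is the substitution `(x, y) ↦ (x, −y − a₁x − a₃)`, the negation of the group law;
Silverman, *AEC*, III.2.3). [cite: SilvermanAEC2009, III.1 Table 3.1] -/
theorem negY_smul : (⟨-1, 0, -W.a₁, -W.a₃⟩ : VariableChange R) • W = W := by
  ext
  · simp only [variableChange_a₁, inv_neg_one, Units.val_neg, Units.val_one]; ring
  · simp only [variableChange_a₂, inv_neg_one, Units.val_neg, Units.val_one]; ring
  · simp only [variableChange_a₃, inv_neg_one, Units.val_neg, Units.val_one]; ring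
  · simp only [variableChange_a₄, inv_neg_one, Units.val_neg, Units.val_one]; ring
  · simp only [variableChange_a₆, inv_neg_one, Units.val_neg, Units.val_one]; ring

/-- Under `ι`: `ι.toX x = x`. [cite: SilvermanAEC2009, III.1 Table 3.1] -/
theorem toX_negY (x : R) : (⟨-1, 0, -W.a₁, -W.a₃⟩ : VariableChange R).toX x = x := by
  simp only [toX_def, inv_neg_one, Units.val_neg, Units.val_one]; ring

/-- Under `ι`: `ι.toY x y = −y − a₁x − a₃ = W.negY x y`. [cite: SilvermanAEC2009, III.1 Table 3.1] -/
theorem toY_negY (x y : R) :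
    (⟨-1, 0, -W.a₁, -W.a₃⟩ : VariableChange R).toY x y = W.toAffine.negY x y := by
  simp only [toY_def, Affine.negY, inv_neg_one, Units.val_neg, Units.val_one]; ring

end NegY

section Aut

variable {F : Type u} [Field F] (W : WeierstrassCurve F)

/-- **The automorphisms of a Weierstrass equation with `c₄ c₆ ≠ 0` are `1` and `ι`** (Silverman,
*AEC*, Thm. III.10.1, case `j ≠ 0, 1728`: `Aut(E) ≅ μ₂`), in the elementary form: over a field with
`2 ≠ 0`, `3 ≠ 0`, if `C • W = W` and `c₄(W) ≠ 0`, `c₆(W) ≠ 0`, then `C = 1` or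
`C = (−1, 0, −a₁, −a₃)`. Proof: `c₄ = u⁻⁴c₄`, `c₆ = u⁻⁶c₆` give `u⁴ = u⁶ = 1`, so `u = ±1`; then
Table 3.1 for `a₁, a₂, a₃` forces `(r, s, t) = (0, 0, 0)` resp. `(0, −a₁, −a₃)`.
[cite: SilvermanAEC2009, Thm. III.10.1] -/
theorem eq_one_or_eq_negY_of_smul_eq {C : VariableChange F} (h2 : (2 : F) ≠ 0) (h3 : (3 : F) ≠ 0)
    (hc₄ : W.c₄ ≠ 0) (hc₆ : W.c₆ ≠ 0) (h : C • W = W) :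
    C = 1 ∨ C = ⟨-1, 0, -W.a₁, -W.a₃⟩ := by
  -- `v := u⁻¹` satisfies `v⁴ = 1`, `v⁶ = 1`, hence `v² = 1`
  set v : F := ((C.u⁻¹ : Fˣ) : F) with hv
  have h4 : v ^ 4 = 1 := by
    have e := congrArg WeierstrassCurve.c₄ h
    rw [variableChange_c₄] at e
    exact mul_right_cancel₀ hc₄ (by rw [one_mul]; exact e)
  have h6 : v ^ 6 = 1 := by
    have e := congrArg WeierstrassCurve.c₆ h
    rw [variableChange_c₆] at e
    exact mul_right_cancel₀ hc₆ (by rw [one_mul]; exact e)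
  have hv0 : v ≠ 0 := by
    intro h0; rw [h0] at h4; norm_num at h4
  have hsq : v ^ 2 = 1 := by
    have : v ^ 4 * v ^ 2 = v ^ 4 * 1 := by rw [mul_one, ← pow_add, h6, h4]
    exact mul_left_cancel₀ (by rw [h4]; exact one_ne_zero) this
  have ha₁ := congrArg WeierstrassCurve.a₁ h
  have ha₂ := congrArg WeierstrassCurve.a₂ h
  have ha₃ := congrArg WeierstrassCurve.a₃ h
  rw [variableChange_a₁] at ha₁
  rw [variableChange_a₂] at ha₂
  rw [variableChange_a₃] at ha₃
  rw [← hv] at ha₁ ha₂ ha₃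
  -- `v = 1` or `v = -1`
  have hv1 : v = 1 ∨ v = -1 := by
    have : (v - 1) * (v + 1) = 0 := by linear_combination hsq
    rcases mul_eq_zero.mp this with h' | h'
    · exact Or.inl (by linear_combination h')
    · exact Or.inr (by linear_combination h')
  rcases hv1 with h1 | h1
  · -- `u = 1`: `s = 0`, `r = 0`, `t = 0`
    left
    rw [h1] at ha₁ ha₂ ha₃
    have hs : C.s = 0 := by
      have : (2 : F) * C.s = 0 := by linear_combination ha₁
      exact (mul_eq_zero.mp this).resolve_left h2
    have hr : C.r = 0 := by
      have : (3 : F) * C.r = 0 := by rw [hs] at ha₂; linear_combination ha₂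
      exact (mul_eq_zero.mp this).resolve_left h3
    have ht : C.t = 0 := by
      have : (2 : F) * C.t = 0 := by rw [hr] at ha₃; linear_combination ha₃
      exact (mul_eq_zero.mp this).resolve_left h2
    have hu : C.u = 1 := by
      have : ((C.u⁻¹ : Fˣ) : F) = 1 := h1
      have h' : C.u⁻¹ = 1 := Units.ext this
      exact inv_eq_one.mp h'
    ext
    · rw [hu]; rfl
    · rw [hr]; rfl
    · rw [hs]; rfl
    · rw [ht]; rfl
  · -- `u = -1`: `s = -a₁`, `r = 0`, `t = -a₃`
    right
    rw [h1] at ha₁ ha₂ ha₃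
    have hs : C.s = -W.a₁ := by
      have : (2 : F) * (C.s + W.a₁) = 0 := by linear_combination -ha₁
      have := (mul_eq_zero.mp this).resolve_left h2
      linear_combination this
    have hr : C.r = 0 := by
      have : (3 : F) * C.r = 0 := by rw [hs] at ha₂; linear_combination ha₂
      exact (mul_eq_zero.mp this).resolve_left h3
    have ht : C.t = -W.a₃ := by
      have : (2 : F) * (C.t + W.a₃) = 0 := by rw [hr] at ha₃; linear_combination -ha₃
      have := (mul_eq_zero.mp this).resolve_left h2
      linear_combination this
    have hu : C.u = -1 := by
      have : ((C.u⁻¹ : Fˣ) : F) = -1 := h1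
      have h' : C.u⁻¹ = -1 := Units.ext (by rw [this, Units.val_neg, Units.val_one])
      rw [← inv_inv C.u, h', inv_neg_one]
    ext
    · rw [hu]
    · rw [hr]
    · rw [hs]
    · rw [ht]

end Aut

/-! ### Point maps: `ι` is negation; identity; composition -/

section Points

variable {F : Type u} [Field F] [DecidableEq F] (W : WeierstrassCurve F)

/-- **`ι = (−1, 0, −a₁, −a₃)` acts on points as negation**: transported back along `ι • W = W`,
`pointEquiv W ι P = −P` (`(x, y) ↦ (x, −y − a₁x − a₃)`, Silverman *AEC* III.2.3).
[cite: SilvermanAEC2009, III.1 Table 3.1] -/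
theorem congrEquiv_pointEquiv_negY (P : W.toAffine.Point) :
    Affine.Point.congrEquiv (negY_smul W) (pointEquiv W ⟨-1, 0, -W.a₁, -W.a₃⟩ P) = -P := by
  rcases P with _ | ⟨x, y, h⟩
  · exact Affine.Point.congrEquiv_zero _
  · rw [pointEquiv_some, Affine.Point.congrEquiv_some, Affine.Point.neg_some]
    simp only [Affine.Point.some.injEq]
    exact ⟨toX_negY W x, toY_negY W x y⟩

/-- The identity change of variables induces the identity on points (along `1 • W = W`). [cite: SilvermanAEC2009, III.1 Table 3.1 and Prop. III.3.1(b)] -/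
theorem congrEquiv_pointEquiv_one (P : W.toAffine.Point) :
    Affine.Point.congrEquiv (one_smul _ W) (pointEquiv W 1 P) = P := by
  rcases P with _ | ⟨x, y, h⟩
  · exact Affine.Point.congrEquiv_zero _
  · rw [pointEquiv_some, Affine.Point.congrEquiv_some]
    simp only [Affine.Point.some.injEq, toX_def, toY_def, one_def, inv_one, Units.val_one]
    constructor <;> ring

variable (C D : VariableChange F)

omit [DecidableEq F] in
/-- The substitution of a product is the composite substitution, `x`-coordinate:
`(D * C).toX = D.toX ∘ C.toX` (`(D * C) • W = D • (C • W)`); private copy of the tree's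
`VariableChange.toX_mul` (`KleinFrickeLevelTwentySeven.lean`, not imported here). [folklore] -/
private theorem toX_mul' (x : F) : (D * C).toX x = D.toX (C.toX x) := by
  have hC := C.u.ne_zero
  have hD := D.u.ne_zero
  simp only [toX_def, mul_def, Units.val_mul, Units.val_inv_eq_inv_val]
  field_simp
  ring

omit [DecidableEq F] in
/-- The substitution of a product is the composite substitution, `y`-coordinate; private copy of
the tree's `VariableChange.toY_mul` (`KleinFrickeLevelTwentySeven.lean`). [folklore] -/
private theorem toY_mul' (x y : F) : (D * C).toY x y = D.toY (C.toX x) (C.toY x y) := by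
  have hC := C.u.ne_zero
  have hD := D.u.ne_zero
  simp only [toY_def, toX_def, mul_def, Units.val_mul, Units.val_inv_eq_inv_val]
  field_simp
  ring

/-- **Composition of the point isomorphisms**: along `(D * C) • W = D • (C • W)`,
`pointEquiv W (D * C) = pointEquiv (C • W) D ∘ pointEquiv W C`. [cite: SilvermanAEC2009, III.1 Table 3.1 and Prop. III.3.1(b)] -/
theorem congrEquiv_pointEquiv_mul (P : W.toAffine.Point) :
    Affine.Point.congrEquiv (mul_smul D C W) (pointEquiv W (D * C) P) =
      pointEquiv (C • W) D (pointEquiv W C P) := by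
  rcases P with _ | ⟨x, y, h⟩
  · simp only [← Affine.Point.zero_def, map_zero]
  · rw [pointEquiv_some, Affine.Point.congrEquiv_some, pointEquiv_some, pointEquiv_some]
    simp only [Affine.Point.some.injEq]
    exact ⟨toX_mul' C D x, toY_mul' C D x y⟩

end Points

/-! ### Galois transport of a change of variables with coefficients in the extension -/

-- (ring-hom versions of the coordinate transport: `VariableChange.ringHom_toX/Y`,
-- `TamagawaVariableChangeProofs.lean`; only the `K`-algebra-map versions are needed here)

section Galois

variable {K : Type u} [Field K] (W₀ X₀ : WeierstrassCurve K) {L : Type v} [Field L] [Algebra K L]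
  {L' : Type w} [Field L'] [Algebra K L']

/-- A `K`-algebra map carries `C.toX x` to `(C.map f).toX (f x)`. [cite: SilvermanAEC2009, III.1 Table 3.1 and Prop. III.3.1(b)] -/
theorem map_toX_algHom (C : VariableChange L) (f : L →ₐ[K] L') (x : L) :
    f (C.toX x) = (C.map (f : L →+* L')).toX (f x) := by
  simp only [toX_def, VariableChange.map, Units.coe_map_inv, MonoidHom.coe_coe, map_mul, map_pow,
    map_sub, AlgHom.coe_toRingHom]

/-- A `K`-algebra map carries `C.toY x y` to `(C.map f).toY (f x) (f y)`. [cite: SilvermanAEC2009, III.1 Table 3.1 and Prop. III.3.1(b)] -/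
theorem map_toY_algHom (C : VariableChange L) (f : L →ₐ[K] L') (x y : L) :
    f (C.toY x y) = (C.map (f : L →+* L')).toY (f x) (f y) := by
  simp only [toY_def, VariableChange.map, Units.coe_map_inv, MonoidHom.coe_coe, map_mul, map_pow,
    map_sub, AlgHom.coe_toRingHom]

/-- If a change of variables `C` with coefficients in `L` carries `W₀ ⊗ L` to `X₀ ⊗ L` (both
equations defined over `K`), then for every `K`-algebra map `f : L → L'` the transported change of
variables `C.map f` carries `W₀ ⊗ L'` to `X₀ ⊗ L'` (apply `f` to `C • (W₀ ⊗ L) = X₀ ⊗ L`; Mathlib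
`map_variableChange`, `map_baseChange`). [cite: SilvermanATAEC1994, Lemma V.5.2 (c) (PDF p. 407)] -/
theorem map_smul_baseChange_eq (C : VariableChange L) (hC : C • W₀.baseChange L = X₀.baseChange L)
    (f : L →ₐ[K] L') : C.map (f : L →+* L') • W₀.baseChange L' = X₀.baseChange L' := by
  have e : (C • W₀.baseChange L).map (f : L →+* L') = (X₀.baseChange L).map (f : L →+* L') := by
    rw [hC]
  rw [← map_variableChange] at e
  have h₁ : (W₀.baseChange L).map (f : L →+* L') = W₀.baseChange L' := W₀.map_baseChange f
  have h₂ : (X₀.baseChange L).map (f : L →+* L') = X₀.baseChange L' := X₀.map_baseChange f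
  rw [h₁, h₂] at e
  exact e

variable [DecidableEq L] [DecidableEq L']

/-- **Galois transport of an isomorphism not defined over the base** (Silverman, *ATAEC*, proof of
Lemma V.5.2 (c): "`ψ(P^σ) = … ψ(P)^σ`" computed from the action of `σ` on the coefficients of
`ψ`): for `ψ_C = ` (transport along `hC`) `∘ pointEquiv C : (W₀ ⊗ L)(L) → (X₀ ⊗ L)(L)` and a
`K`-algebra map `f : L → L'`, `f(ψ_C(P)) = ψ_{C.map f}(f(P))`. [cite: SilvermanATAEC1994, Lemma V.5.2 (c) (PDF p. 407)] -/
theorem map_congrEquiv_pointEquiv (C : VariableChange L) (hC : C • W₀.baseChange L = X₀.baseChange L)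
    (f : L →ₐ[K] L') (hC' : C.map (f : L →+* L') • W₀.baseChange L' = X₀.baseChange L')
    (P : (W₀.baseChange L).toAffine.Point) :
    Affine.Point.map f (Affine.Point.congrEquiv hC (pointEquiv (W₀.baseChange L) C P)) =
      Affine.Point.congrEquiv hC'
        (pointEquiv (W₀.baseChange L') (C.map (f : L →+* L')) (Affine.Point.map f P)) := by
  rcases P with _ | ⟨x, y, h⟩
  · simp only [← Affine.Point.zero_def, map_zero]
  · rw [pointEquiv_some, Affine.Point.congrEquiv_some, Affine.Point.map_some, Affine.Point.map_some,
      pointEquiv_some, Affine.Point.congrEquiv_some]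
    simp only [Affine.Point.some.injEq]
    exact ⟨map_toX_algHom C f x, map_toY_algHom C f x y⟩

omit [DecidableEq L] [DecidableEq L'] in
/-- **The Galois conjugate of such a `C` is `C` or `ι * C`** (Silverman, *ATAEC*, proof of V.5.2 (c)
and *AEC* III.10.1): for `σ ∈ Aut(L/K)`, `(C.map σ) * C⁻¹` fixes `X₀ ⊗ L`, so if `c₄(X₀) c₆(X₀) ≠ 0`
and `6 ≠ 0` in `K` it is `1` or `ι = (−1, 0, −a₁(X₀), −a₃(X₀))`.
[cite: SilvermanATAEC1994, Lemma V.5.2 (c) (PDF p. 407)] -/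
theorem map_eq_self_or_eq_negY_mul (C : VariableChange L) (hC : C • W₀.baseChange L = X₀.baseChange L)
    (σ : L →ₐ[K] L) (h2 : (2 : K) ≠ 0) (h3 : (3 : K) ≠ 0) (hc₄ : X₀.c₄ ≠ 0) (hc₆ : X₀.c₆ ≠ 0) :
    C.map (σ : L →+* L) = C ∨
      C.map (σ : L →+* L) =
        ⟨-1, 0, -(X₀.baseChange L).a₁, -(X₀.baseChange L).a₃⟩ * C := by
  have hD : (C.map (σ : L →+* L) * C⁻¹) • X₀.baseChange L = X₀.baseChange L := by
    rw [mul_smul, show C⁻¹ • X₀.baseChange L = W₀.baseChange L by rw [← hC, inv_smul_smul]]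
    exact map_smul_baseChange_eq W₀ X₀ C hC σ
  have h2L : (2 : L) ≠ 0 := by
    have := (map_ne_zero (algebraMap K L)).mpr h2; rwa [map_ofNat] at this
  have h3L : (3 : L) ≠ 0 := by
    have := (map_ne_zero (algebraMap K L)).mpr h3; rwa [map_ofNat] at this
  have hc₄L : (X₀.baseChange L).c₄ ≠ 0 := by
    change (X₀.map (algebraMap K L)).c₄ ≠ 0
    rw [map_c₄]; exact (map_ne_zero _).mpr hc₄
  have hc₆L : (X₀.baseChange L).c₆ ≠ 0 := by
    change (X₀.map (algebraMap K L)).c₆ ≠ 0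
    rw [map_c₆]; exact (map_ne_zero _).mpr hc₆
  rcases eq_one_or_eq_negY_of_smul_eq (X₀.baseChange L) h2L h3L hc₄L hc₆L hD with h | h
  · left
    have := congrArg (· * C) h
    simpa only [inv_mul_cancel_right, one_mul] using this
  · right
    have := congrArg (· * C) h
    simpa only [inv_mul_cancel_right] using this

omit [DecidableEq L] [DecidableEq L'] in
/-- The `u`-component decides the case: `C.map σ = C` has `σ u = u`, `C.map σ = ι * C` has
`σ u = −u`; so (with `2 ≠ 0`) `σ u = u` excludes the second case. [cite: SilvermanAEC2009, Thm. III.10.1] -/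
theorem map_u_eq_neg_of_map_eq_negY_mul (C : VariableChange L) (σ : L →ₐ[K] L)
    (h : C.map (σ : L →+* L) = ⟨-1, 0, -(X₀.baseChange L).a₁, -(X₀.baseChange L).a₃⟩ * C) :
    σ (C.u : L) = -(C.u : L) := by
  have := congrArg (fun D : VariableChange L => ((D.u : Lˣ) : L)) h
  simpa [VariableChange.map, mul_def, Units.val_mul] using this

omit [DecidableEq L] [DecidableEq L'] in
/-- Conversely `C.map σ = C` gives `σ u = u`. [cite: SilvermanAEC2009, Thm. III.10.1] -/
theorem map_u_eq_of_map_eq (C : VariableChange L) (σ : L →ₐ[K] L) (h : C.map (σ : L →+* L) = C) :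
    σ (C.u : L) = (C.u : L) := by
  have := congrArg (fun D : VariableChange L => ((D.u : Lˣ) : L)) h
  simpa [VariableChange.map] using this


omit [DecidableEq L] [DecidableEq L'] in
/-- In the dichotomy `C.map σ = C ∨ C.map σ = ι * C`, the case is read off the `u`-component:
if `σ u = u` (and `2 ≠ 0`) then `C.map σ = C`. [cite: SilvermanAEC2009, Thm. III.10.1] -/
theorem map_eq_self_of_map_u_eq (C : VariableChange L) (σ : L →ₐ[K] L)
    (hdich : C.map (σ : L →+* L) = C ∨
      C.map (σ : L →+* L) = ⟨-1, 0, -(X₀.baseChange L).a₁, -(X₀.baseChange L).a₃⟩ * C)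
    (h2 : (2 : L) ≠ 0) (hu : σ (C.u : L) = (C.u : L)) : C.map (σ : L →+* L) = C := by
  rcases hdich with h | h
  · exact h
  · exfalso
    have hneg := map_u_eq_neg_of_map_eq_negY_mul X₀ C σ h
    rw [hu] at hneg
    have : (2 : L) * (C.u : L) = 0 := by linear_combination hneg
    rcases mul_eq_zero.mp this with h0 | h0
    · exact h2 h0
    · exact C.u.ne_zero h0

omit [DecidableEq L] [DecidableEq L'] in
/-- In the dichotomy `C.map σ = C ∨ C.map σ = ι * C`: if `σ u ≠ u` then `C.map σ = ι * C`. [cite: SilvermanAEC2009, Thm. III.10.1] -/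
theorem map_eq_negY_mul_of_map_u_ne (C : VariableChange L) (σ : L →ₐ[K] L)
    (hdich : C.map (σ : L →+* L) = C ∨
      C.map (σ : L →+* L) = ⟨-1, 0, -(X₀.baseChange L).a₁, -(X₀.baseChange L).a₃⟩ * C)
    (hu : σ (C.u : L) ≠ (C.u : L)) :
    C.map (σ : L →+* L) = ⟨-1, 0, -(X₀.baseChange L).a₁, -(X₀.baseChange L).a₃⟩ * C := by
  rcases hdich with h | h
  · exact absurd (map_u_eq_of_map_eq C σ h) hu
  · exact h

/-- **Case `C.map σ = C`: `σ(ψ(P)) = ψ(σ(P))`** for `ψ = ` transport `∘ pointEquiv C`.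
[cite: SilvermanATAEC1994, Lemma V.5.2 (c) (PDF p. 407)] -/
theorem map_congrEquiv_pointEquiv_of_map_eq (C : VariableChange L)
    (hC : C • W₀.baseChange L = X₀.baseChange L) (σ : L →ₐ[K] L) (hσ : C.map (σ : L →+* L) = C)
    (P : (W₀.baseChange L).toAffine.Point) :
    Affine.Point.map σ (Affine.Point.congrEquiv hC (pointEquiv (W₀.baseChange L) C P)) =
      Affine.Point.congrEquiv hC (pointEquiv (W₀.baseChange L) C (Affine.Point.map σ P)) := by
  rcases P with _ | ⟨x, y, h⟩
  · simp only [← Affine.Point.zero_def, map_zero]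
  · rw [pointEquiv_some, Affine.Point.congrEquiv_some, Affine.Point.map_some, Affine.Point.map_some,
      pointEquiv_some, Affine.Point.congrEquiv_some]
    simp only [Affine.Point.some.injEq]
    refine ⟨?_, ?_⟩
    · rw [map_toX_algHom C σ x, hσ]
    · rw [map_toY_algHom C σ x y, hσ]

/-- **Case `C.map σ = ι * C`: `σ(ψ(P)) = −ψ(σ(P))`** (the sign `χ(σ) = −1` of Silverman's
`ψ(P^σ) = χ(σ)ψ(P)^σ`). [cite: SilvermanATAEC1994, Lemma V.5.2 (c) (PDF p. 407)] -/
theorem map_congrEquiv_pointEquiv_of_map_eq_negY_mul (C : VariableChange L)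
    (hC : C • W₀.baseChange L = X₀.baseChange L) (σ : L →ₐ[K] L)
    (hσ : C.map (σ : L →+* L) = ⟨-1, 0, -(X₀.baseChange L).a₁, -(X₀.baseChange L).a₃⟩ * C)
    (P : (W₀.baseChange L).toAffine.Point) :
    Affine.Point.map σ (Affine.Point.congrEquiv hC (pointEquiv (W₀.baseChange L) C P)) =
      -Affine.Point.congrEquiv hC (pointEquiv (W₀.baseChange L) C (Affine.Point.map σ P)) := by
  rcases P with _ | ⟨x, y, h⟩
  · simp only [← Affine.Point.zero_def, map_zero, neg_zero]
  · rw [pointEquiv_some, Affine.Point.congrEquiv_some, Affine.Point.map_some, Affine.Point.map_some,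
      pointEquiv_some, Affine.Point.congrEquiv_some, Affine.Point.neg_some]
    simp only [Affine.Point.some.injEq]
    refine ⟨?_, ?_⟩
    · rw [map_toX_algHom C σ x, hσ, toX_mul', toX_negY]
    · rw [map_toY_algHom C σ x y, hσ, toY_mul', toY_negY]

end Galois

end WeierstrassCurve.VariableChange

end
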